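import Summits.HubbardSuperconductivity.HubbardLadder.Bounds.NumberConservingTrialDirectionCeiling
import Summits.HubbardSuperconductivity.HubbardLadder.Bounds.StiffnessCeilingTrialDirection
import Summits.HubbardSuperconductivity.HubbardLadder.Bounds.NumberConservingStiffnessCeiling
import HarnessLib

/-!
# Bounds nodes: gauge-function form, optimal scaling, current-moment form and no-current
# corollaries of the trial-direction stiffness ceiling for the number-conserving class
# (`bounds.tex` Theorem 6(ii)–(iv))

HONEST FRAMING: ladder R1–R4 with certified numbers; no claim on H/H₀. BOUNDS FOR A MODEL CLASS (no
materials claim, no certified instance claimed), proved sorry-free; nothing here is a cited fact.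

Cell `pub-hubbard`, unit `pub-hubbard-bounds` (gen 9). Setting of
`NumberConservingTrialDirectionCeiling.lean`, now with `V` invariant under every site-phase gauge
`W_φ` (`W_φᴴ V W_φ = V`, i.e. `V` a function of the `n_{xσ}`-algebra… any density–density
interaction and potential), so that `W_{θχ}ᴴ H(θd) W_{θχ} = H(θ(d + dχ))` and the sector flux curve
of `d + dχ` is that of `d` (`minEnergyOn_szSector_peierls_gauge`). With
`G₁(χ) = ½ Σ_{x,y,σ} (d_{xy} + χ_y − χ_x)² (−t_{xy} Re⟨ψ, c†_{xσ}c_{yσ}ψ⟩)`, `J = J_{d+dχ}`,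
`B(η) = Re⟨η, H₀η⟩ − E₀‖η‖²`, under `ρ θ² ≤ E(θ) − E(0)` (`|θ| ≤ θ₀`), all PROVED:
* `TrialDirectionStiffnessCeilingNumberConserving`: `ρ ≤ G₁(χ) − 2Re⟨η, Jψ⟩ + B(η)` for every
  gauge `χ` and every sector vector `η` (bounds.tex Thm 6(ii));
* `OptimalTrialDirectionCeilingNumberConserving`: `B(η) ≥ 0` and `ρ ≤ G₁(χ) − Re⟨η,Jψ⟩²/B(η)`;
* `CurrentMomentStiffnessCeilingNumberConserving` (`η = μJψ`): `ρ ≤ G₁(χ) − 2μ‖Jψ‖² +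
  μ²(Re⟨Jψ, H₀Jψ⟩ − E₀‖Jψ‖²)` — bounds.tex Thm 5 for the general class, computable from `ψ` alone;
* `CurrentDecouplesGroundSpaceNumberConserving`: `⟨η, Jψ⟩ = 0` for every sector ground state `η`
  (necessary for ANY two-sided quadratic flux floor; the Hylleraas infimum is the finite Kubo term);
* `NoGroundStateCurrentNumberConserving`: `⟨ψ, J_{d+dχ}ψ⟩ = 0` (conditional finite-volume Bloch
  theorem);
* edge `stiffnessCeilingNumberConserving_of_trialDirection`: `η = 0` gives bounds.tex Thm 4 at
  `T = 0` (`StiffnessCeilingNumberConserving`, `NumberConservingStiffnessCeiling.lean`).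

References: Scalapino–White–Zhang, PRB 47 (1993) 7995, §II; Paramekanti–Trivedi–Randeria, PRB 57
(1998) 11639, §IV; Bloch's theorem on persistent currents: D. Bohm, Phys. Rev. 75 (1949) 502
(we prove only the stated conditional finite-volume form). Combination and formal proofs ours.
-/

noncomputable section

namespace Summit.HubbardSuperconductivity.HubbardLadder.Bounds

open Matrix Finset Literature.MathematicalPhysics.QuantumLattice
  Literature.MathematicalPhysics.QuantumFieldTheory

open scoped ComplexConjugate ComplexOrder

/-! ### Gauge covariance and sector preservation -/

section Hopping

variable {Λ : Type} [LinearOrder Λ] [Fintype Λ]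

/-- `T(τ)` conserves `N↑` and `N↓` (maps every `(N, S^z)` sector into itself). [folklore] -/
theorem preservesSectors_bdgHopping (τ : Λ → Λ → ℂ) : PreservesSectors (bdgHopping τ) := by
  unfold bdgHopping
  exact PreservesSectors.sum fun x _ => PreservesSectors.sum fun y _ =>
    PreservesSectors.sum fun σ _ => (LiebThm1.preservesSectors_hopping x y σ).smul _

/-- **Gauge covariance of the sector flux curve**: `E_{N,M}(H(θ(d + dχ))) = E_{N,M}(H(θd))` for
every `V` invariant under the site-phase gauge group (`W_{θχ}ᴴ H(θd) W_{θχ} = H(θ(d + dχ))` and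
`minEnergyOn_szSector_phaseGauge_conj`). [folklore] -/
theorem minEnergyOn_szSector_peierls_gauge (t d : Λ → Λ → ℝ)
    {V : Matrix (Finset (Orb Λ)) (Finset (Orb Λ)) ℂ}
    (hVg : ∀ φ : Λ → ℝ,
      (phaseGauge fun x => Circle.exp (φ x))ᴴ * V * phaseGauge (fun x => Circle.exp (φ x)) = V)
    (N : ℕ) (M θ : ℝ) (χ : Λ → ℝ) :
    ((bdgHopping fun x y =>
          (t x y : ℂ) * Complex.exp (((θ * (d x y + (χ y - χ x)) : ℝ) : ℂ) * Complex.I)) +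
          V).minEnergyOn (szSector N M) =
      ((bdgHopping fun x y => (t x y : ℂ) * Complex.exp (((θ * d x y : ℝ) : ℂ) * Complex.I)) +
          V).minEnergyOn (szSector N M) := by
  have hg := conjTranspose_phaseGauge_mul_bdgHopping_peierls_mul_phaseGauge t (fun x y => θ * d x y)
    (fun x => θ * χ x)
  beta_reduce at hg
  have hV' : (phaseGauge fun x => Circle.exp (θ * χ x))ᴴ * V *
      phaseGauge (fun x => Circle.exp (θ * χ x)) = V := hVg _
  have hτ : (fun x y => (t x y : ℂ) *
        Complex.exp (((θ * (d x y + (χ y - χ x)) : ℝ) : ℂ) * Complex.I)) =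
      fun x y => (t x y : ℂ) *
        Complex.exp (((θ * d x y + (θ * χ y - θ * χ x) : ℝ) : ℂ) * Complex.I) := by
    funext x y
    rw [mul_add, mul_sub]
  rw [hτ, ← hg]
  nth_rewrite 1 [← hV']
  rw [← Matrix.add_mul, ← Matrix.mul_add]
  exact minEnergyOn_szSector_phaseGauge_conj _ _ N M

end Hopping

/-! ### The nodes (every gauge `χ`, every trial direction `η`) -/

section Nodes

/-- **Trial-direction (Hylleraas) stiffness ceiling for the number-conserving class**
(`@[conjecture] def`, PROVED by `trialDirectionStiffnessCeilingNumberConserving_holds`;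
bounds.tex Theorem 6; T = 0; a BOUND FOR A MODEL CLASS). For every finite `Λ`, real symmetric
hopping `t`, antisymmetric one-form `d`, Hermitian gauge-invariant `V` and sector `(N, M)`: if
`ρ θ² ≤ E_{N,M}(H(θd)) − E_{N,M}(H₀)` for `|θ| ≤ θ₀` (`θ₀ > 0`, `ρ` of either sign), then for every
unit sector ground state `ψ` of `H₀ = T(t) + V`, every gauge function `χ : Λ → ℝ` and every vector
`η` of the sector, `ρ ≤ ½ Σ_{x,y,σ} (d_{xy} + χ_y − χ_x)² (−t_{xy} Re⟨ψ, c†_{xσ}c_{yσ}ψ⟩)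
  − 2 Re⟨η, J_{d+dχ} ψ⟩ + (Re⟨η, H₀η⟩ − E₀‖η‖²)`, `J_u = T(i t u)`. -/
@[conjecture] def TrialDirectionStiffnessCeilingNumberConserving : Prop :=
  ∀ (Λ : Type) [LinearOrder Λ] [Fintype Λ] (t d : Λ → Λ → ℝ),
    (∀ x y, t y x = t x y) → (∀ x y, d y x = -d x y) →
    ∀ (V : Matrix (Finset (Orb Λ)) (Finset (Orb Λ)) ℂ), V.IsHermitian →
    (∀ φ : Λ → ℝ,
      (phaseGauge fun x => Circle.exp (φ x))ᴴ * V * phaseGauge (fun x => Circle.exp (φ x)) = V) →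
    ∀ (N : ℕ) (M ρ θ₀ : ℝ), 0 < θ₀ →
    (∀ θ : ℝ, |θ| ≤ θ₀ →
      ρ * θ ^ 2 ≤
        ((bdgHopping fun x y => (t x y : ℂ) * Complex.exp (((θ * d x y : ℝ) : ℂ) * Complex.I)) +
              V).minEnergyOn (szSector N M) -
          ((bdgHopping fun x y => (t x y : ℂ)) + V).minEnergyOn (szSector N M)) →
    ∀ ψ : Fock (Orb Λ), IsGroundStateInSector ((bdgHopping fun x y => (t x y : ℂ)) + V) N M ψ →
      star ψ ⬝ᵥ ψ = 1 → ∀ (χ : Λ → ℝ) (η : Fock (Orb Λ)), η ∈ szSector N M →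
      ρ ≤ (∑ x : Λ, ∑ y : Λ, ∑ σ : Fin 2, (d x y + (χ y - χ x)) ^ 2 *
            (-(t x y * (star ψ ⬝ᵥ ((creation (orb x σ) * annihilation (orb y σ)) *ᵥ ψ)).re) /
              2)) -
          2 * (star η ⬝ᵥ (bdgHopping
            (fun x y => ((t x y * (d x y + (χ y - χ x)) : ℝ) : ℂ) * Complex.I) *ᵥ ψ)).re +
          ((star η ⬝ᵥ (((bdgHopping fun x y => (t x y : ℂ)) + V) *ᵥ η)).re -
            ((bdgHopping fun x y => (t x y : ℂ)) + V).minEnergyOn (szSector N M) *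
              (star η ⬝ᵥ η).re)

/-- **`TrialDirectionStiffnessCeilingNumberConserving` holds**
(`TrialDirectionStiffnessCeilingOneForm` for the one-form `d + dχ`, whose flux curve is that of
`d` by `minEnergyOn_szSector_peierls_gauge`). -/
theorem trialDirectionStiffnessCeilingNumberConserving_holds :
    TrialDirectionStiffnessCeilingNumberConserving := by
  intro Λ _ _ t d ht hd V hV hVg N M ρ θ₀ hθ₀ hstiff ψ hgs h1 χ η hη
  have h := trialDirectionStiffnessCeilingOneForm_holds Λ t (fun x y => d x y + (χ y - χ x)) ht
    (fun x y => by rw [hd x y]; ring) V hV N M ρ θ₀ hθ₀ (fun θ hθ => by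
      rw [minEnergyOn_szSector_peierls_gauge t d hVg]
      exact hstiff θ hθ) ψ hgs h1 η hη
  beta_reduce at h
  exact h

/-- **Optimal scaling of the trial direction** (`@[conjecture] def`, PROVED by
`optimalTrialDirectionCeilingNumberConserving_holds`; bounds.tex Thm 6(ii)): with
`A = Re⟨η, J_{d+dχ}ψ⟩`, `B = Re⟨η, H₀η⟩ − E₀‖η‖² ≥ 0`, `ρ ≤ G₁(χ) − A²/B` (`x/0 = 0`). -/
@[conjecture] def OptimalTrialDirectionCeilingNumberConserving : Prop :=
  ∀ (Λ : Type) [LinearOrder Λ] [Fintype Λ] (t d : Λ → Λ → ℝ),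
    (∀ x y, t y x = t x y) → (∀ x y, d y x = -d x y) →
    ∀ (V : Matrix (Finset (Orb Λ)) (Finset (Orb Λ)) ℂ), V.IsHermitian →
    (∀ φ : Λ → ℝ,
      (phaseGauge fun x => Circle.exp (φ x))ᴴ * V * phaseGauge (fun x => Circle.exp (φ x)) = V) →
    ∀ (N : ℕ) (M ρ θ₀ : ℝ), 0 < θ₀ →
    (∀ θ : ℝ, |θ| ≤ θ₀ →
      ρ * θ ^ 2 ≤
        ((bdgHopping fun x y => (t x y : ℂ) * Complex.exp (((θ * d x y : ℝ) : ℂ) * Complex.I)) +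
              V).minEnergyOn (szSector N M) -
          ((bdgHopping fun x y => (t x y : ℂ)) + V).minEnergyOn (szSector N M)) →
    ∀ ψ : Fock (Orb Λ), IsGroundStateInSector ((bdgHopping fun x y => (t x y : ℂ)) + V) N M ψ →
      star ψ ⬝ᵥ ψ = 1 → ∀ (χ : Λ → ℝ) (η : Fock (Orb Λ)), η ∈ szSector N M →
      0 ≤ (star η ⬝ᵥ (((bdgHopping fun x y => (t x y : ℂ)) + V) *ᵥ η)).re -
          ((bdgHopping fun x y => (t x y : ℂ)) + V).minEnergyOn (szSector N M) *
            (star η ⬝ᵥ η).re ∧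
      ρ ≤ (∑ x : Λ, ∑ y : Λ, ∑ σ : Fin 2, (d x y + (χ y - χ x)) ^ 2 *
            (-(t x y * (star ψ ⬝ᵥ ((creation (orb x σ) * annihilation (orb y σ)) *ᵥ ψ)).re) /
              2)) -
          (star η ⬝ᵥ (bdgHopping
            (fun x y => ((t x y * (d x y + (χ y - χ x)) : ℝ) : ℂ) * Complex.I) *ᵥ ψ)).re ^ 2 /
          ((star η ⬝ᵥ (((bdgHopping fun x y => (t x y : ℂ)) + V) *ᵥ η)).re -
            ((bdgHopping fun x y => (t x y : ℂ)) + V).minEnergyOn (szSector N M) *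
              (star η ⬝ᵥ η).re)

/-- **`OptimalTrialDirectionCeilingNumberConserving` holds** (`η ↦ (A/B) • η`). -/
theorem optimalTrialDirectionCeilingNumberConserving_holds :
    OptimalTrialDirectionCeilingNumberConserving := by
  intro Λ _ _ t d ht hd V hV hVg N M ρ θ₀ hθ₀ hstiff ψ hgs h1 χ η hη
  refine ⟨sub_nonneg.2 (minEnergyOn_mul_re_le ((isHermitian_bdgHopping_real ht).add hV)
    (szSector N M) hη), ?_⟩
  have h := fun μ : ℝ => trialDirectionStiffnessCeilingNumberConserving_holds Λ t d ht hd V hV hVg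
    N M ρ θ₀ hθ₀ hstiff ψ hgs h1 χ ((μ : ℂ) • η) (Submodule.smul_mem _ _ hη)
  simp only [re_star_ofReal_smul_dotProduct_mulVec_smul, re_star_ofReal_smul_dotProduct_smul] at h
  simp only [re_star_ofReal_smul_dotProduct] at h
  generalize (star η ⬝ᵥ (bdgHopping
    (fun x y => ((t x y * (d x y + (χ y - χ x)) : ℝ) : ℂ) * Complex.I) *ᵥ ψ)).re = A at h ⊢
  generalize (star η ⬝ᵥ (((bdgHopping fun x y => (t x y : ℂ)) + V) *ᵥ η)).re = ηH at h ⊢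
  generalize (star η ⬝ᵥ η).re = a at h ⊢
  generalize ((bdgHopping fun x y => (t x y : ℂ)) + V).minEnergyOn (szSector N M) = E₀ at h ⊢
  generalize (∑ x : Λ, ∑ y : Λ, ∑ σ : Fin 2, (d x y + (χ y - χ x)) ^ 2 *
    (-(t x y * (star ψ ⬝ᵥ ((creation (orb x σ) * annihilation (orb y σ)) *ᵥ ψ)).re) / 2)) = G₁
    at h ⊢
  by_cases hb : ηH - E₀ * a = 0
  · have h0 := h 0
    rw [hb, div_zero]
    linarith
  · have hμ := h (A / (ηH - E₀ * a))
    have hid : -(2 * (A / (ηH - E₀ * a) * A)) +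
        ((A / (ηH - E₀ * a)) ^ 2 * ηH - E₀ * ((A / (ηH - E₀ * a)) ^ 2 * a)) =
        -(A ^ 2 / (ηH - E₀ * a)) := by
      field_simp
      ring
    linarith

/-- **Current-moment ceiling for the number-conserving class** (`@[conjecture] def`, PROVED by
`currentMomentStiffnessCeilingNumberConserving_holds`; bounds.tex Thm 5 for the general class:
`η = μ J_{d+dχ}ψ`): with `Jψ = J_{d+dχ}ψ`, `M₀ = ‖Jψ‖²`, for every real `μ`,
`ρ ≤ G₁(χ) − 2μ M₀ + μ² (Re⟨Jψ, H₀ Jψ⟩ − E₀ M₀)`. -/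
@[conjecture] def CurrentMomentStiffnessCeilingNumberConserving : Prop :=
  ∀ (Λ : Type) [LinearOrder Λ] [Fintype Λ] (t d : Λ → Λ → ℝ),
    (∀ x y, t y x = t x y) → (∀ x y, d y x = -d x y) →
    ∀ (V : Matrix (Finset (Orb Λ)) (Finset (Orb Λ)) ℂ), V.IsHermitian →
    (∀ φ : Λ → ℝ,
      (phaseGauge fun x => Circle.exp (φ x))ᴴ * V * phaseGauge (fun x => Circle.exp (φ x)) = V) →
    ∀ (N : ℕ) (M ρ θ₀ : ℝ), 0 < θ₀ →
    (∀ θ : ℝ, |θ| ≤ θ₀ →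
      ρ * θ ^ 2 ≤
        ((bdgHopping fun x y => (t x y : ℂ) * Complex.exp (((θ * d x y : ℝ) : ℂ) * Complex.I)) +
              V).minEnergyOn (szSector N M) -
          ((bdgHopping fun x y => (t x y : ℂ)) + V).minEnergyOn (szSector N M)) →
    ∀ ψ : Fock (Orb Λ), IsGroundStateInSector ((bdgHopping fun x y => (t x y : ℂ)) + V) N M ψ →
      star ψ ⬝ᵥ ψ = 1 → ∀ (χ : Λ → ℝ) (μ : ℝ),
      ρ ≤ (∑ x : Λ, ∑ y : Λ, ∑ σ : Fin 2, (d x y + (χ y - χ x)) ^ 2 *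
            (-(t x y * (star ψ ⬝ᵥ ((creation (orb x σ) * annihilation (orb y σ)) *ᵥ ψ)).re) /
              2)) -
          2 * μ * (star (bdgHopping
              (fun x y => ((t x y * (d x y + (χ y - χ x)) : ℝ) : ℂ) * Complex.I) *ᵥ ψ) ⬝ᵥ
            (bdgHopping
              (fun x y => ((t x y * (d x y + (χ y - χ x)) : ℝ) : ℂ) * Complex.I) *ᵥ ψ)).re +
          μ ^ 2 * ((star (bdgHopping
              (fun x y => ((t x y * (d x y + (χ y - χ x)) : ℝ) : ℂ) * Complex.I) *ᵥ ψ) ⬝ᵥ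
            (((bdgHopping fun x y => (t x y : ℂ)) + V) *ᵥ (bdgHopping
              (fun x y => ((t x y * (d x y + (χ y - χ x)) : ℝ) : ℂ) * Complex.I) *ᵥ ψ))).re -
            ((bdgHopping fun x y => (t x y : ℂ)) + V).minEnergyOn (szSector N M) *
              (star (bdgHopping
                (fun x y => ((t x y * (d x y + (χ y - χ x)) : ℝ) : ℂ) * Complex.I) *ᵥ ψ) ⬝ᵥ
              (bdgHopping
                (fun x y => ((t x y * (d x y + (χ y - χ x)) : ℝ) : ℂ) * Complex.I) *ᵥ ψ)).re)

/-- **`CurrentMomentStiffnessCeilingNumberConserving` holds** (`η = μ Jψ`, a sector vector by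
`preservesSectors_bdgHopping`). -/
theorem currentMomentStiffnessCeilingNumberConserving_holds :
    CurrentMomentStiffnessCeilingNumberConserving := by
  intro Λ _ _ t d ht hd V hV hVg N M ρ θ₀ hθ₀ hstiff ψ hgs h1 χ μ
  have h := trialDirectionStiffnessCeilingNumberConserving_holds Λ t d ht hd V hV hVg N M ρ θ₀ hθ₀
    hstiff ψ hgs h1 χ ((μ : ℂ) • (bdgHopping
      (fun x y => ((t x y * (d x y + (χ y - χ x)) : ℝ) : ℂ) * Complex.I) *ᵥ ψ))
    (Submodule.smul_mem _ _
      (mulVec_mem_szSector_of_preservesSectors (preservesSectors_bdgHopping _) hgs.1))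
  rw [re_star_ofReal_smul_dotProduct_mulVec_smul, re_star_ofReal_smul_dotProduct_smul,
    re_star_ofReal_smul_dotProduct] at h
  linarith

/-- A sector vector `η` with `Re⟨η, H₀η⟩ = E₀‖η‖²` (a ground vector) has `Re⟨η, J_{d+dχ}ψ⟩ = 0`
under the two-sided quadratic flux hypothesis (`η ↦ λ • η`, `λ → ±∞`). [folklore] -/
theorem re_star_dotProduct_current_mulVec_eq_zero {Λ : Type} [LinearOrder Λ] [Fintype Λ]
    {t d : Λ → Λ → ℝ} (ht : ∀ x y, t y x = t x y) (hd : ∀ x y, d y x = -d x y)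
    {V : Matrix (Finset (Orb Λ)) (Finset (Orb Λ)) ℂ} (hV : V.IsHermitian)
    (hVg : ∀ φ : Λ → ℝ,
      (phaseGauge fun x => Circle.exp (φ x))ᴴ * V * phaseGauge (fun x => Circle.exp (φ x)) = V)
    {N : ℕ} {M ρ θ₀ : ℝ} (hθ₀ : 0 < θ₀)
    (hstiff : ∀ θ : ℝ, |θ| ≤ θ₀ →
      ρ * θ ^ 2 ≤
        ((bdgHopping fun x y => (t x y : ℂ) * Complex.exp (((θ * d x y : ℝ) : ℂ) * Complex.I)) +
              V).minEnergyOn (szSector N M) -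
          ((bdgHopping fun x y => (t x y : ℂ)) + V).minEnergyOn (szSector N M))
    {ψ η : Fock (Orb Λ)}
    (hgs : IsGroundStateInSector ((bdgHopping fun x y => (t x y : ℂ)) + V) N M ψ)
    (h1 : star ψ ⬝ᵥ ψ = 1) (χ : Λ → ℝ) (hη : η ∈ szSector N M)
    (hB : (star η ⬝ᵥ (((bdgHopping fun x y => (t x y : ℂ)) + V) *ᵥ η)).re =
      ((bdgHopping fun x y => (t x y : ℂ)) + V).minEnergyOn (szSector N M) * (star η ⬝ᵥ η).re) :
    (star η ⬝ᵥ (bdgHopping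
      (fun x y => ((t x y * (d x y + (χ y - χ x)) : ℝ) : ℂ) * Complex.I) *ᵥ ψ)).re = 0 := by
  have h := fun μ : ℝ => trialDirectionStiffnessCeilingNumberConserving_holds Λ t d ht hd V hV hVg
    N M ρ θ₀ hθ₀ hstiff ψ hgs h1 χ ((μ : ℂ) • η) (Submodule.smul_mem _ _ hη)
  simp only [re_star_ofReal_smul_dotProduct_mulVec_smul, re_star_ofReal_smul_dotProduct_smul,
    hB] at h
  simp only [re_star_ofReal_smul_dotProduct] at h
  generalize (star η ⬝ᵥ (bdgHopping
    (fun x y => ((t x y * (d x y + (χ y - χ x)) : ℝ) : ℂ) * Complex.I) *ᵥ ψ)).re = A at h ⊢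
  generalize (∑ x : Λ, ∑ y : Λ, ∑ σ : Fin 2, (d x y + (χ y - χ x)) ^ 2 *
    (-(t x y * (star ψ ⬝ᵥ ((creation (orb x σ) * annihilation (orb y σ)) *ᵥ ψ)).re) / 2)) = G₁
    at h
  by_contra hA
  have hμ := h ((G₁ - ρ + 1) / (2 * A))
  have hid : 2 * ((G₁ - ρ + 1) / (2 * A) * A) = G₁ - ρ + 1 := by
    field_simp
  linarith [hμ, hid]

/-- **The current decouples the sector ground space** (`@[conjecture] def`, PROVED by
`currentDecouplesGroundSpaceNumberConserving_holds`; bounds.tex Thm 6(iii)): under the two-sided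
quadratic flux floor `ρ θ² ≤ E(θ) − E(0)` (`|θ| ≤ θ₀`, any real `ρ`), `⟨η, J_{d+dχ} ψ⟩ = 0` for
every unit sector ground state `ψ`, every gauge `χ` and EVERY sector ground state `η` — a
necessary condition for any quadratic flux floor, and the statement that the infimum of the
Hylleraas functional over `η` is the finite Kubo term. -/
@[conjecture] def CurrentDecouplesGroundSpaceNumberConserving : Prop :=
  ∀ (Λ : Type) [LinearOrder Λ] [Fintype Λ] (t d : Λ → Λ → ℝ),
    (∀ x y, t y x = t x y) → (∀ x y, d y x = -d x y) →
    ∀ (V : Matrix (Finset (Orb Λ)) (Finset (Orb Λ)) ℂ), V.IsHermitian →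
    (∀ φ : Λ → ℝ,
      (phaseGauge fun x => Circle.exp (φ x))ᴴ * V * phaseGauge (fun x => Circle.exp (φ x)) = V) →
    ∀ (N : ℕ) (M ρ θ₀ : ℝ), 0 < θ₀ →
    (∀ θ : ℝ, |θ| ≤ θ₀ →
      ρ * θ ^ 2 ≤
        ((bdgHopping fun x y => (t x y : ℂ) * Complex.exp (((θ * d x y : ℝ) : ℂ) * Complex.I)) +
              V).minEnergyOn (szSector N M) -
          ((bdgHopping fun x y => (t x y : ℂ)) + V).minEnergyOn (szSector N M)) →
    ∀ ψ : Fock (Orb Λ), IsGroundStateInSector ((bdgHopping fun x y => (t x y : ℂ)) + V) N M ψ →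
      star ψ ⬝ᵥ ψ = 1 → ∀ (χ : Λ → ℝ) (η : Fock (Orb Λ)),
      IsGroundStateInSector ((bdgHopping fun x y => (t x y : ℂ)) + V) N M η →
      star η ⬝ᵥ (bdgHopping
        (fun x y => ((t x y * (d x y + (χ y - χ x)) : ℝ) : ℂ) * Complex.I) *ᵥ ψ) = 0

/-- **`CurrentDecouplesGroundSpaceNumberConserving` holds** (real part from
`re_star_dotProduct_current_mulVec_eq_zero` at `η`, imaginary part at `i • η`). -/
theorem currentDecouplesGroundSpaceNumberConserving_holds :
    CurrentDecouplesGroundSpaceNumberConserving := by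
  intro Λ _ _ t d ht hd V hV hVg N M ρ θ₀ hθ₀ hstiff ψ hgs h1 χ η hgsη
  obtain ⟨hηS, -, hHη⟩ := hgsη
  have hB : (star η ⬝ᵥ (((bdgHopping fun x y => (t x y : ℂ)) + V) *ᵥ η)).re =
      ((bdgHopping fun x y => (t x y : ℂ)) + V).minEnergyOn (szSector N M) * (star η ⬝ᵥ η).re := by
    rw [hHη, dotProduct_smul, smul_eq_mul, Complex.re_ofReal_mul]
  have hBI : (star (Complex.I • η) ⬝ᵥ
      (((bdgHopping fun x y => (t x y : ℂ)) + V) *ᵥ (Complex.I • η))).re =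
      ((bdgHopping fun x y => (t x y : ℂ)) + V).minEnergyOn (szSector N M) *
        (star (Complex.I • η) ⬝ᵥ (Complex.I • η)).re := by
    rw [star_I_smul_dotProduct_mulVec_I_smul, star_I_smul_dotProduct_I_smul, hB]
  have hre := re_star_dotProduct_current_mulVec_eq_zero ht hd hV hVg hθ₀ hstiff hgs h1 χ hηS hB
  have him := re_star_dotProduct_current_mulVec_eq_zero ht hd hV hVg hθ₀ hstiff hgs h1 χ
    (Submodule.smul_mem _ _ hηS) hBI
  rw [re_star_I_smul_dotProduct] at him
  exact Complex.ext hre him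

/-- **No ground-state current** (`@[conjecture] def`, PROVED by
`noGroundStateCurrentNumberConserving_holds`; `η = ψ` in
`CurrentDecouplesGroundSpaceNumberConserving`): a unit sector ground state `ψ` whose sector flux
curve has a two-sided quadratic floor `ρ θ² ≤ E(θ) − E(0)` (`|θ| ≤ θ₀`, any real `ρ`) carries no
current along any gauge-equivalent one-form: `⟨ψ, J_{d+dχ} ψ⟩ = 0` (a conditional finite-volume
Bloch theorem for the number-conserving class). -/
@[conjecture] def NoGroundStateCurrentNumberConserving : Prop :=
  ∀ (Λ : Type) [LinearOrder Λ] [Fintype Λ] (t d : Λ → Λ → ℝ),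
    (∀ x y, t y x = t x y) → (∀ x y, d y x = -d x y) →
    ∀ (V : Matrix (Finset (Orb Λ)) (Finset (Orb Λ)) ℂ), V.IsHermitian →
    (∀ φ : Λ → ℝ,
      (phaseGauge fun x => Circle.exp (φ x))ᴴ * V * phaseGauge (fun x => Circle.exp (φ x)) = V) →
    ∀ (N : ℕ) (M ρ θ₀ : ℝ), 0 < θ₀ →
    (∀ θ : ℝ, |θ| ≤ θ₀ →
      ρ * θ ^ 2 ≤
        ((bdgHopping fun x y => (t x y : ℂ) * Complex.exp (((θ * d x y : ℝ) : ℂ) * Complex.I)) +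
              V).minEnergyOn (szSector N M) -
          ((bdgHopping fun x y => (t x y : ℂ)) + V).minEnergyOn (szSector N M)) →
    ∀ ψ : Fock (Orb Λ), IsGroundStateInSector ((bdgHopping fun x y => (t x y : ℂ)) + V) N M ψ →
      star ψ ⬝ᵥ ψ = 1 → ∀ χ : Λ → ℝ,
      star ψ ⬝ᵥ (bdgHopping
        (fun x y => ((t x y * (d x y + (χ y - χ x)) : ℝ) : ℂ) * Complex.I) *ᵥ ψ) = 0

/-- **`NoGroundStateCurrentNumberConserving` holds** (`η = ψ`). -/
theorem noGroundStateCurrentNumberConserving_holds : NoGroundStateCurrentNumberConserving :=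
  fun Λ _ _ t d ht hd V hV hVg N M ρ θ₀ hθ₀ hstiff ψ hgs h1 χ =>
    currentDecouplesGroundSpaceNumberConserving_holds Λ t d ht hd V hV hVg N M ρ θ₀ hθ₀ hstiff ψ
      hgs h1 χ ψ hgs

/-- **Edge to `bounds.tex` Theorem 4 at `T = 0`**: the trial direction `η = 0` turns
`TrialDirectionStiffnessCeilingNumberConserving` into the gauge-function (resistor-network)
ceiling `StiffnessCeilingNumberConserving` of `NumberConservingStiffnessCeiling.lean`. -/
theorem stiffnessCeilingNumberConserving_of_trialDirection
    (h : TrialDirectionStiffnessCeilingNumberConserving) : StiffnessCeilingNumberConserving := by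
  intro Λ _ _ t d ht hd V hV hVg N M ρ θ₀ hθ₀ hstiff ψ hgs h1 χ
  have key := h Λ t d ht hd V hV hVg N M ρ θ₀ hθ₀ hstiff ψ hgs h1 χ 0 (Submodule.zero_mem _)
  simpa only [star_zero, zero_dotProduct, Complex.zero_re, mul_zero, sub_zero, add_zero]
    using key

end Nodes

end Summit.HubbardSuperconductivity.HubbardLadder.Bounds

end
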